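import Summits.Ventures.PercRepro.ProfilePointedCircuitClassesInOutFree

/-!
# PercRepro — THE WEAK SECOND STEP AT EVERY NULLITY, AND THE BOTTOM-LEVEL EXCHANGE BOUND `in_4(e) ≤ 4·out_4(e)`
(p5, gen 38; `proofs/P5-GM1.md` §54(c)(3), (g))

* At nullity `ν` (`#E = ρ + ν`, `ρ ≥ ν + 3`) and level `ν + 1`: for `W ∈ BI_{ν+1}` at most `ν` points of `E ∖ W` lie in
  `cl(W)` (`ν + 1` of them would span `W`, and a further point `x` of `E ∖ W` would give `ρ(E − x) ≤ ρ − 2`), so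
  every `W` has at least `ρ − 1 − ν` extensions in `BI_{ν+2}` while every `V ∈ BI_{ν+2}` has at most `ν + 2` subsets
  in `BI_{ν+1}`: **`(ρ − 1 − ν)·P_{ν+1} ≤ (ν + 2)·P_{ν+2}`** (`biIndep_weak_step_succ_of_nullity`; the case `ν = 3` is
  `biIndep_weak_step_four_of_nullity_three`).
* At the bottom of nullity `4`, for EVERY point `e`: **`in_4(e) ≤ 4·out_4(e)`** — a bi-independent `4`-set `W ∋ e`
  (so `B := E ∖ W` is a basis avoiding `e`) has some `f` in the fundamental circuit of `e` in `B` with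
  `f ∉ cl(W − e)` (else `e ∈ cl(fundC) ⊆ cl(W − e)`, against `W ∈ ℐ`), and `(W − e) + f` is then a bi-independent
  `4`-set avoiding `e`; each such set arises from at most `4` pairs.  This is the coloop-limit form of the sharp bottom
  inequality `(n − 5)·in_4(e) ≤ 4·out_5(e)` (§54(c)(3)): `out_5(e)` grows by `c·out_4(e)` under `c` added coloops.
-/

open scoped Matroid

namespace PercRepro.Cogirth

open Finset ThmH Skew Shadow Profile

variable {α : Type} [DecidableEq α]

section WeakStepSucc

variable {M : Matroid α} [M.Finite]

/-- Closure is idempotent (`rk (cl X) = rk X`). -/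
theorem mem_clF_of_mem_clF_clF {X : Finset α} (hX : X ⊆ gr M) {y : α} (hy : y ∈ clF M (clF M X)) :
    y ∈ clF M X := by
  have hyg : y ∈ gr M := clF_subset_gr _ hy
  rw [mem_clF_iff_rk_insert_eq hyg (clF_subset_gr X)] at hy
  rw [mem_clF_iff_rk_insert_eq hyg hX]
  have hXcl : X ⊆ clF M X := fun x hx => mem_clF_of_mem_of_subset_gr hX hx
  have h1 := rk_le_rk_of_subset_finset (M := M) (insert_subset_insert y hXcl)
  have h2 := rk_le_rk_of_subset_finset (M := M) (subset_insert y X)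
  rw [hy, rk_clF_eq_rk] at h1
  omega

/-- **THE `ν`-POINT LEMMA** (nullity `ν`, level `ν + 1`): for `W ∈ BI_{ν+1}` of a matroid with `#E = ρ(E) + ν`,
`ρ(E) ≥ ν + 3`, at most `ν` points of `E ∖ W` lie in `cl(W)`. -/
theorem card_filter_mem_clF_le_of_biIndep_succ {ν : ℕ} (hn : (gr M).card = rk M (gr M) + ν)
    (hR : ν + 3 ≤ rk M (gr M)) {W : Finset α} (hW : W ∈ biIndepSets M (ν + 1)) :
    ((gr M \ W).filter (fun a => a ∈ clF M W)).card ≤ ν := by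
  rw [mem_biIndepSets] at hW
  obtain ⟨hWg, hWk, hWrk, hWc⟩ := hW
  by_contra hcon
  have h4 : ν + 1 ≤ ((gr M \ W).filter (fun a => a ∈ clF M W)).card := by omega
  obtain ⟨A, hAsub, hAk⟩ := exists_subset_card_eq h4
  have hAW : A ⊆ gr M \ W := hAsub.trans (filter_subset _ _)
  have hAcl : A ⊆ clF M W := fun a ha => (mem_filter.1 (hAsub ha)).2
  have hAg : A ⊆ gr M := hAW.trans sdiff_subset
  have hArk : rk M A = ν + 1 := by
    have := rk_eq_card_of_subset_of_rk_eq_card hAW hWc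
    rwa [hAk] at this
  have hWA : rk M (W ∪ A) = ν + 1 := by
    have h1 : W ∪ A ⊆ clF M W := union_subset (fun w hw => mem_clF_of_mem_of_subset_gr hWg hw) hAcl
    have h2 := rk_le_rk_of_subset_finset (M := M) h1
    rw [rk_clF_eq_rk, hWrk, hWk] at h2
    have h3 := rk_le_rk_of_subset_finset (M := M) (subset_union_left (s₁ := W) (s₂ := A))
    rw [hWrk, hWk] at h3
    omega
  have hWclA : W ⊆ clF M A := by
    intro w hw
    rw [mem_clF_iff_rk_insert_eq (hWg hw) hAg]
    have h1 := rk_le_rk_of_subset_finset (M := M)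
      (insert_subset (mem_union_left A hw) (subset_union_right (s₁ := W) (s₂ := A)))
    have h2 := rk_le_rk_of_subset_finset (M := M) (subset_insert w A)
    omega
  have hcardWc : (gr M \ W).card = rk M (gr M) - 1 := by
    rw [card_sdiff_of_subset hWg, hWk]
    omega
  obtain ⟨x, hxWc, hxA⟩ := exists_mem_notMem_of_card_lt_card (show A.card < (gr M \ W).card by omega)
  have hxg : x ∈ gr M := (mem_sdiff.1 hxWc).1
  have hsub : (gr M).erase x ⊆ clF M ((gr M \ W).erase x) := by
    intro y hy
    rw [mem_erase] at hy
    by_cases hyW : y ∈ W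
    · have hA' : A ⊆ (gr M \ W).erase x := by
        intro a ha
        rw [mem_erase]
        exact ⟨fun h => hxA (h ▸ ha), hAW ha⟩
      exact mem_clF_of_subset hA' (hWclA hyW)
    · exact mem_clF_of_mem_of_subset_gr ((erase_subset _ _).trans sdiff_subset)
        (mem_erase.2 ⟨hy.1, mem_sdiff.2 ⟨hy.2, hyW⟩⟩)
  have h1 := rk_le_rk_of_subset_finset (M := M) hsub
  rw [rk_clF_eq_rk] at h1
  have h2 := rk_le_card (M := M) ((gr M \ W).erase x)
  rw [card_erase_of_mem hxWc, hcardWc] at h2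
  have h3 := rk_le_rk_erase_add_one (M := M) (Subset.refl (gr M)) hxg
  omega

/-- **THE WEAK SECOND STEP AT EVERY NULLITY**: on `#E = ρ(E) + ν`, `ρ(E) ≥ ν + 3`,
`(ρ − 1 − ν)·P_{ν+1} ≤ (ν + 2)·P_{ν+2}` (containment double counting with the `ν`-point lemma). -/
theorem biIndep_weak_step_succ_of_nullity {ν : ℕ} (hn : (gr M).card = rk M (gr M) + ν)
    (hR : ν + 3 ≤ rk M (gr M)) :
    (rk M (gr M) - 1 - ν) * (biIndepSets M (ν + 1)).card ≤ (ν + 2) * (biIndepSets M (ν + 2)).card := by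
  set D := biIndepSets M (ν + 1) with hD
  set U := biIndepSets M (ν + 2) with hU
  have hdeg : ∀ W ∈ D, rk M (gr M) - 1 - ν ≤ (U.filter (fun V => W ⊆ V)).card := by
    intro W hW
    have hW' := hW
    rw [hD, mem_biIndepSets] at hW'
    obtain ⟨hWg, hWk, hWrk, hWc⟩ := hW'
    have hnu := card_filter_mem_clF_le_of_biIndep_succ hn hR hW
    have hsplit := card_filter_add_card_filter_not (s := gr M \ W) (p := fun a => a ∈ clF M W)
    have hcardWc : (gr M \ W).card = rk M (gr M) - 1 := by
      rw [card_sdiff_of_subset hWg, hWk]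
      omega
    have hmaps : ∀ a ∈ (gr M \ W).filter (fun a => a ∉ clF M W), insert a W ∈ U.filter (fun V => W ⊆ V) := by
      intro a ha
      rw [mem_filter, mem_sdiff] at ha
      obtain ⟨⟨hag, haW⟩, hacl⟩ := ha
      rw [mem_filter, hU, mem_biIndepSets]
      refine ⟨⟨insert_subset hag hWg, ?_, ?_, ?_⟩, subset_insert a W⟩
      · rw [card_insert_of_notMem haW, hWk]
      · rw [rk_insert_eq hag hWg, if_neg hacl, hWrk, card_insert_of_notMem haW]
      · rw [sdiff_insert]
        exact rk_eq_card_of_subset_of_rk_eq_card (erase_subset _ _) hWc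
    have hinj : Set.InjOn (fun a => insert a W) ((gr M \ W).filter (fun a => a ∉ clF M W) : Finset α) := by
      intro a ha b hb hab
      rw [mem_coe, mem_filter, mem_sdiff] at ha hb
      simp only at hab
      have : a ∈ insert b W := hab ▸ mem_insert_self a W
      rw [mem_insert] at this
      rcases this with h | h
      · exact h
      · exact absurd h ha.1.2
    calc rk M (gr M) - 1 - ν ≤ ((gr M \ W).filter (fun a => a ∉ clF M W)).card := by omega
      _ ≤ (U.filter (fun V => W ⊆ V)).card := card_le_card_of_injOn _ hmaps hinj
  have hco : ∀ V ∈ U, (D.filter (fun W => W ⊆ V)).card ≤ ν + 2 := by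
    intro V hV
    rw [hU, mem_biIndepSets] at hV
    obtain ⟨hVg, hVk, hVrk, hVc⟩ := hV
    have hsub : D.filter (fun W => W ⊆ V) ⊆ V.image (fun a => V.erase a) := by
      intro W hW
      rw [mem_filter] at hW
      obtain ⟨hWD, hWV⟩ := hW
      rw [hD, mem_biIndepSets] at hWD
      obtain ⟨_, hWk, _, _⟩ := hWD
      obtain ⟨a, haV, haW⟩ := exists_mem_notMem_of_card_lt_card (show W.card < V.card by omega)
      rw [mem_image]
      refine ⟨a, haV, ?_⟩
      have hWe : W = V.erase a := by
        apply eq_of_subset_of_card_le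
        · intro w hw
          rw [mem_erase]
          exact ⟨fun h => haW (h ▸ hw), hWV hw⟩
        · rw [card_erase_of_mem haV, hVk, hWk]
          omega
      exact hWe.symm
    calc (D.filter (fun W => W ⊆ V)).card ≤ (V.image (fun a => V.erase a)).card := card_le_card hsub
      _ ≤ V.card := card_image_le
      _ = ν + 2 := hVk
  have h := sum_card_bipartiteAbove_eq_sum_card_bipartiteBelow (r := fun (W V : Finset α) => W ⊆ V) (s := D) (t := U)
  simp only [bipartiteAbove, bipartiteBelow] at h
  have h1 : D.card * (rk M (gr M) - 1 - ν) ≤ ∑ W ∈ D, (U.filter (fun V => W ⊆ V)).card := by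
    rw [← smul_eq_mul]
    exact card_nsmul_le_sum _ _ _ hdeg
  have h2 : ∑ V ∈ U, (D.filter (fun W => W ⊆ V)).card ≤ U.card * (ν + 2) := by
    rw [← smul_eq_mul]
    exact sum_le_card_nsmul _ _ _ hco
  have h3 : D.card * (rk M (gr M) - 1 - ν) ≤ U.card * (ν + 2) := by omega
  rw [mul_comm, mul_comm (ν + 2)]
  exact h3

end WeakStepSucc

section Exchange

variable {N : Matroid α} [N.Finite]

/-- **THE BOTTOM-LEVEL EXCHANGE BOUND**: on `#E = ρ(E) + 4`, `in_4(e) ≤ 4·out_4(e)` for every point `e` — every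
bi-independent `4`-set through `e` exchanges `e` for a point `f` of the fundamental circuit of `e` in the basis
`E ∖ W` with `f ∉ cl(W − e)`, and each bi-independent `4`-set avoiding `e` is hit at most `4` times. -/
theorem inCount_four_le_four_mul_outCount_four (hn : (gr N).card = rk N (gr N) + 4) (e : α) :
    inCount N 4 e ≤ 4 * outCount N 4 e := by
  unfold inCount outCount
  set D := (biIndepSets N 4).filter (fun X => e ∈ X) with hD
  set U := (biIndepSets N 4).filter (fun X => e ∉ X) with hU
  -- every demand `W` has a unit `(W − e) + f`
  have hdeg : ∀ W ∈ D, 1 ≤ (U.filter (fun V => W.erase e ⊆ V)).card := by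
    intro W hW
    rw [hD, mem_filter, mem_biIndepSets] at hW
    obtain ⟨⟨hWg, hW4, hWrk, hWc⟩, heW⟩ := hW
    have heg : e ∈ gr N := hWg heW
    set B := gr N \ W with hB
    have hBg : B ⊆ gr N := sdiff_subset
    have heB : e ∉ B := fun h => (mem_sdiff.1 h).2 heW
    have hBcard : B.card = rk N (gr N) := by
      rw [hB, card_sdiff_of_subset hWg, hW4]
      omega
    -- `e ∈ cl(B)` (`B` is a basis)
    have hecl : e ∈ clF N B := by
      rw [mem_clF_iff_rk_insert_eq heg hBg]
      have h1 := rk_le_rk_of_subset_finset (M := N) (insert_subset heg hBg : insert e B ⊆ gr N)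
      have h2 := rk_le_rk_of_subset_finset (M := N) (subset_insert e B)
      rw [hWc, hBcard] at *
      omega
    -- `e ∉ cl(W − e)`
    have hecl' : e ∉ clF N (W.erase e) := by
      intro h
      rw [mem_clF_iff_rk_insert_eq heg ((erase_subset _ _).trans hWg), insert_erase heW] at h
      have := rk_le_card (M := N) (W.erase e)
      rw [card_erase_of_mem heW] at this
      omega
    -- some `f` of the fundamental circuit lies off `cl(W − e)`
    have hex : ∃ f ∈ fundC N B e, f ∉ clF N (W.erase e) := by
      by_contra hall
      have hall' : ∀ f ∈ fundC N B e, f ∈ clF N (W.erase e) := by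
        intro f hf
        by_contra h
        exact hall ⟨f, hf, h⟩
      have hS := mem_clF_sdiff_of_forall_notMem_fundC heg hBg hWc hecl (B.filter (fun b => b ∉ clF N (W.erase e)))
        (filter_subset _ _) (fun w hw hwf => (mem_filter.1 hw).2 (hall' w hwf))
      have hsub : B \ B.filter (fun b => b ∉ clF N (W.erase e)) ⊆ clF N (W.erase e) := by
        intro b hb
        rw [mem_sdiff, mem_filter, not_and] at hb
        exact not_not.1 (hb.2 hb.1)
      exact hecl' (mem_clF_of_mem_clF_clF ((erase_subset _ _).trans hWg) (mem_clF_of_subset hsub hS))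
    obtain ⟨f, hfF, hfcl⟩ := hex
    have hfB : f ∈ B := fundC_subset B e hfF
    have hfg : f ∈ gr N := hBg hfB
    have hfW : f ∉ W := (mem_sdiff.1 hfB).2
    have hef : e ≠ f := fun h => hfW (h ▸ heW)
    -- the unit `V := (W − e) + f`
    have hV : insert f (W.erase e) ∈ U.filter (fun V => W.erase e ⊆ V) := by
      rw [mem_filter, hU, mem_filter, mem_biIndepSets]
      have hWeg : W.erase e ⊆ gr N := (erase_subset _ _).trans hWg
      have hfWe : f ∉ W.erase e := fun h => hfW (erase_subset _ _ h)
      refine ⟨⟨⟨insert_subset hfg hWeg, ?_, ?_, ?_⟩, ?_⟩, subset_insert f _⟩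
      · rw [card_insert_of_notMem hfWe, card_erase_of_mem heW, hW4]
      · rw [rk_insert_eq hfg hWeg, if_neg hfcl, card_insert_of_notMem hfWe]
        have := rk_eq_card_of_subset_of_rk_eq_card (erase_subset e W) hWrk
        omega
      · -- `E ∖ ((W − e) + f) = (B − f) + e` is independent: `e ∉ cl(B − f)` since `f ∈ fundC`
        have e1 : gr N \ insert f (W.erase e) = insert e (B.erase f) := by
          ext a
          simp only [mem_sdiff, mem_insert, mem_erase, hB]
          constructor
          · rintro ⟨hag, h⟩
            by_cases hae : a = e
            · exact Or.inl hae
            · exact Or.inr ⟨fun haf => h (Or.inl haf), hag, fun haW => h (Or.inr ⟨hae, haW⟩)⟩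
          · rintro (rfl | ⟨haf, hag, haW⟩)
            · exact ⟨heg, fun h => h.elim (fun h' => hef h') (fun h' => h'.1 rfl)⟩
            · exact ⟨hag, fun h => h.elim haf (fun h' => haW h'.2)⟩
        have hfund : e ∉ clF N (B.erase f) := by
          unfold fundC at hfF
          exact (mem_filter.1 hfF).2
        have hBeg : B.erase f ⊆ gr N := (erase_subset _ _).trans hBg
        have heBe : e ∉ B.erase f := fun h => heB (erase_subset _ _ h)
        rw [e1, rk_insert_eq heg hBeg, if_neg hfund, card_insert_of_notMem heBe]
        have := rk_eq_card_of_subset_of_rk_eq_card (erase_subset f B) hWc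
        omega
      · rw [mem_insert, not_or]
        exact ⟨hef, fun h => (mem_erase.1 h).1 rfl⟩
    exact card_pos.2 ⟨_, hV⟩
  -- every unit `V` has at most `4` demands `(V − f) + e` below it
  have hco : ∀ V ∈ U, (D.filter (fun W => W.erase e ⊆ V)).card ≤ 4 := by
    intro V hV
    rw [hU, mem_filter, mem_biIndepSets] at hV
    obtain ⟨⟨hVg, hV4, hVrk, hVc⟩, heV⟩ := hV
    have hsub : D.filter (fun W => W.erase e ⊆ V) ⊆ V.image (fun f => insert e (V.erase f)) := by
      intro W hW
      rw [mem_filter] at hW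
      obtain ⟨hWD, hWV⟩ := hW
      rw [hD, mem_filter, mem_biIndepSets] at hWD
      obtain ⟨⟨_, hW4, _, _⟩, heW⟩ := hWD
      have hcard : (W.erase e).card = 3 := by rw [card_erase_of_mem heW, hW4]
      obtain ⟨f, hfV, hfW⟩ := exists_mem_notMem_of_card_lt_card (show (W.erase e).card < V.card by omega)
      rw [mem_image]
      refine ⟨f, hfV, ?_⟩
      have hWe : W.erase e = V.erase f := by
        apply eq_of_subset_of_card_le
        · intro w hw
          rw [mem_erase]
          exact ⟨fun h => hfW (h ▸ hw), hWV hw⟩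
        · rw [card_erase_of_mem hfV, hV4, hcard]
      rw [← hWe, insert_erase heW]
    calc (D.filter (fun W => W.erase e ⊆ V)).card ≤ (V.image (fun f => insert e (V.erase f))).card := card_le_card hsub
      _ ≤ V.card := card_image_le
      _ = 4 := hV4
  have h := sum_card_bipartiteAbove_eq_sum_card_bipartiteBelow (r := fun (W V : Finset α) => W.erase e ⊆ V) (s := D) (t := U)
  simp only [bipartiteAbove, bipartiteBelow] at h
  have h1 : D.card * 1 ≤ ∑ W ∈ D, (U.filter (fun V => W.erase e ⊆ V)).card := by
    rw [← smul_eq_mul]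
    exact card_nsmul_le_sum _ _ _ hdeg
  have h2 : ∑ V ∈ U, (D.filter (fun W => W.erase e ⊆ V)).card ≤ U.card * 4 := by
    rw [← smul_eq_mul]
    exact sum_le_card_nsmul _ _ _ hco
  omega

end Exchange

end PercRepro.Cogirth
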